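import Literature.MathematicalPhysics.QuantumFieldTheory.Balaban1983to89.B9Ineq368L2MLetters
import Literature.MathematicalPhysics.QuantumFieldTheory.Balaban1983to89.B9Ineq349L2ReadingsP

/-!
# `Balaban1983to89.B9Ineq368L2MLettersP` — B9 p. 403 (3.66)–(3.68) IN BLOCK-`ℓ²`, THE SANDWICHED `C⁻¹`-LETTERS WITH THE `C⁻¹` CARRIER GENERIC (a block carrier
# `Y` with block map `blkY`, e.g. NODE 00's `BlkY × ι`): `C(U′U) − C(U)`, `C⁻¹(U′U) − C⁻¹(U)`, `M′ − M` from READINGS — g6's `B9Ineq368L2MLetters` with the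
# lattice of blocks replaced by `Y` and the (3.48) entry bounds by block-`ℓ²` majorants (pub-ymgap N06 row 13, G side, `L²` member: brick F2b of the `Read377L2` port)

T. Bałaban, *Propagators for lattice gauge theories in a background field*, Commun. Math. Phys. **99** (1985) 389–434
[`Balaban1985BackgroundPropagators`, "B9"], (3.21) p. 394, (3.57) p. 401, (3.65)–(3.68) p. 403, Thm 3.2 (3.48) p. 398; [4] = T. Bałaban, *Propagators and
renormalization transformations for lattice gauge theories. II*, Commun. Math. Phys. **96** (1984) 223–250 [`Balaban1984PropagatorsII`], (2.52)–(2.55) p. 232,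
Lemma 2.1 p. 234, Prop. 2.6 (2.140)–(2.141) p. 247.

statement-level skeleton of published theorems with citation tags; proofs where landed; nothing here is a claim about the Yang–Mills mass gap

WHY THIS FILE (seat dag-n06-c gen 14, READ377L2-PORT-PLAN F2b).  The proofs of `B9Ineq368L2MLetters` are carrier-agnostic; NODE 00's `C⁻¹(V)` is matrix valued
and lives on `BlkY × ι`.  This file restates `hasL2Majorant_sandwich_rev`, `hasL2Majorant_cDiff_sites`, `hasL2Majorant_copDiff_sites`,
`hasL2Majorant_mDiff_of_readings` with the middle carrier `Y` (suffix `P`), the (3.48) data as block-`ℓ²` majorants on `Y`; the algebra (`cinv_sub_eq`,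
`csq_sub_expand`, `m_sub_expand`) is g6's, used by name.

HONEST SCOPE.  Finite-dimensional bookkeeping; every letter a binder with its reading as hypothesis; nothing of [B9] asserted for Bałaban's operators;
count-neutral; NOT a node discharge; nothing continuum ∕ OS ∕ mass-gap ∕ Clay.  Cell `pub-ymgap` (HUMAN RULING D-0062), Track A node N06 [B9], row 13, 2026-08-29.
-/

noncomputable section

open scoped BigOperators

namespace Literature.MathematicalPhysics.QuantumFieldTheory.Balaban1983to89.B9Ineq368L2MLettersP

open B6RandomWalk (Triangle254 Ineq261)
open B6RandomWalkL2 (l2n HasL2Majorant hasL2Majorant_mono hasL2Majorant_add)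
open B6RandomWalkL2Hom (HasL2MajorantHom hasL2MajorantHom_iff hasL2MajorantHom_mono hasL2MajorantHom_add hasL2MajorantHom_comp)
open B9Thm34Ext (toB6)
open B9Ineq347 (ScaleTransfer)
open B9Ineq363L2 (hasL2Majorant_rate_mono hasL2Majorant_comp_decay)
open B9Ineq377L2 (hasL2Majorant_neg hasL2Majorant_sub)
open B9Ineq366CPrime (scaleTransfer_one)
open B9Ineq368L2MLetters (cinv_sub_eq sq_sub_sq_expand csq_sub_expand m_sub_expand)
open B9Ineq349L2ReadingsP (hasL2Majorant_sandwichP)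

variable {g : B9.Geometry} [Fintype g.Site] [DecidableEq g.Site] {R : ℝ} {H : Prop} {X Y : Type} [Fintype X] [Fintype Y]

/-! ## §1  The reverse sandwich `Q′∘L∘Q′*` on the lattice of blocks -/

/-- **THE REVERSE SANDWICH THROUGH THE FINE CARRIER, IN BLOCK-ℓ² ON 𝔅** (the words `Q′·(…)·Q′*` of `C(V) = Q′G′²Q′*`, (3.21)/(3.66)): if `Q′ : X → 𝔅` has the
diagonal `ℓ²` Hom-majorant `κ_c·w_c(y)𝟙`, the fine-carrier operator `L` has `L ≺₂ B·v(y)·e^{−δd}`, `Q′* : 𝔅 → X` has `κ_s·w_s(y)𝟙`, `w_s·w_c ≦ 1` and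
`e^{−αδd(y,y′)}w_c(y′) ≦ Λ·w_c(y)`, then ON 𝔅 (identity block map) `Q′∘L∘Q′* ≺₂ (κ_cκ_sBΛ)·v(y)·e^{−(1−α)δd}` — the factor `w_c(y)·w_s(y′)` costs one
volume-ratio transfer from the input block `y′` to the output block `y`.
[cite: Balaban1984PropagatorsII, (2.52)–(2.55) p.232 + (2.140)–(2.141) p.247; Balaban1985BackgroundPropagators, (3.21) p.393 + (3.66) p.403 + p.398 (remark after (3.47)); derivation ours] -/
theorem hasL2Majorant_sandwich_revP (blkX : X → g.Site) (blkY : Y → g.Site) (δ α Λ κc κs B : ℝ) (wc ws v : g.Site → ℝ)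
    (hκc : 0 ≤ κc) (hκs : 0 ≤ κs) (hB : 0 ≤ B) (hΛ : 0 ≤ Λ) (hwc : ∀ a, 0 ≤ wc a) (hws : ∀ a, 0 ≤ ws a) (hv : ∀ a, 0 ≤ v a)
    (hprod : ∀ a, ws a * wc a ≤ 1) (hsym : ∀ a b : g.Site, g.dist a b = g.dist b a)
    (hT : ∀ a b : g.Site, Real.exp (-(α * δ * g.dist a b)) * wc b ≤ Λ * wc a)
    {Qc : (X → ℝ) →ₗ[ℝ] (Y → ℝ)} {L : Module.End ℝ (X → ℝ)} {Qcs : (Y → ℝ) →ₗ[ℝ] (X → ℝ)}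
    (hQc : HasL2MajorantHom (g := toB6 g R H) blkX blkY Qc (fun a b : g.Site => if a = b then κc * wc a else 0))
    (hL : HasL2Majorant (g := toB6 g R H) blkX L (fun a b => B * v a * Real.exp (-(δ * g.dist a b))))
    (hQcs : HasL2MajorantHom (g := toB6 g R H) blkY blkX Qcs (fun a b : g.Site => if a = b then κs * ws a else 0)) :
    HasL2Majorant (g := toB6 g R H) blkY (Qc ∘ₗ L ∘ₗ Qcs)
      (fun a b => (κc * κs * B * Λ) * v a * Real.exp (-((1 - α) * δ * g.dist a b))) := by
  letI : DecidableEq (toB6 g R H).Site := ‹DecidableEq g.Site›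
  -- L ∘ Q′* : 𝔅 → X
  have hKL : ∀ a b : g.Site, 0 ≤ B * v a * Real.exp (-(δ * g.dist a b)) := fun a b => by have := hv a; positivity
  have hLQ : HasL2MajorantHom (g := toB6 g R H) blkY blkX (L ∘ₗ Qcs)
      (fun a b => B * v a * Real.exp (-(δ * g.dist a b)) * (κs * ws b)) := by
    have h := hasL2MajorantHom_comp (g := toB6 g R H) blkY blkX blkX (S := (L : (X → ℝ) →ₗ[ℝ] (X → ℝ)))
      hQcs ((hasL2MajorantHom_iff (g := toB6 g R H) _ _ _).mpr hL) hKL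
    refine hasL2MajorantHom_mono (g := toB6 g R H) _ _ h fun a b => le_of_eq ?_
    rw [Finset.sum_eq_single b]
    · simp
    · intro y'' _ hne
      split_ifs with h
      · exact absurd h hne
      · rw [mul_zero]
    · intro hb; exact absurd (Finset.mem_univ b) hb
  -- Q′ ∘ (L ∘ Q′*) : 𝔅 → 𝔅
  have hK : ∀ a b : g.Site, 0 ≤ (if a = b then κc * wc a else 0) := fun a b => by
    split_ifs
    · exact mul_nonneg hκc (hwc a)
    · exact le_rfl
  have h3 := hasL2MajorantHom_comp (g := toB6 g R H) blkY blkX blkY hLQ hQc hK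
  have h3' : HasL2Majorant (g := toB6 g R H) blkY (Qc ∘ₗ L ∘ₗ Qcs)
      (fun a b => (κc * wc a) * (B * v a * Real.exp (-(δ * g.dist a b)) * (κs * ws b))) := by
    refine (hasL2MajorantHom_iff (g := toB6 g R H) _ _ _).mp (hasL2MajorantHom_mono (g := toB6 g R H) _ _ h3 fun a b => le_of_eq ?_)
    rw [Finset.sum_eq_single a]
    · simp
    · intro y'' _ hne
      split_ifs with h
      · exact absurd h.symm hne
      · rw [zero_mul]
    · intro ha; exact absurd (Finset.mem_univ a) ha
  refine hasL2Majorant_mono (g := toB6 g R H) _ h3' fun a b => ?_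
  -- w_c(a)·w_s(b) ≤ w_c(a)/w_c(b)-type: e^{−αδd(b,a)}·w_c(a) ≤ Λ·w_c(b), then w_s(b)·w_c(b) ≤ 1
  have hsplit : Real.exp (-(δ * g.dist a b)) = Real.exp (-((1 - α) * δ * g.dist a b)) * Real.exp (-(α * δ * g.dist b a)) := by
    rw [← Real.exp_add, hsym b a]; congr 1; ring
  have htr := hT b a
  have hE : 0 ≤ Real.exp (-((1 - α) * δ * g.dist a b)) := Real.exp_nonneg _
  calc κc * wc a * (B * v a * Real.exp (-(δ * g.dist a b)) * (κs * ws b))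
      = (κc * κs * B * v a * Real.exp (-((1 - α) * δ * g.dist a b))) * (ws b * (Real.exp (-(α * δ * g.dist b a)) * wc a)) := by
        rw [hsplit]; ring
    _ ≤ (κc * κs * B * v a * Real.exp (-((1 - α) * δ * g.dist a b))) * (ws b * (Λ * wc b)) := by
        refine mul_le_mul_of_nonneg_left (mul_le_mul_of_nonneg_left htr (hws b)) ?_
        have := hv a; positivity
    _ = (κc * κs * B * Λ) * v a * Real.exp (-((1 - α) * δ * g.dist a b)) * (ws b * wc b) := by ring
    _ ≤ (κc * κs * B * Λ) * v a * Real.exp (-((1 - α) * δ * g.dist a b)) * 1 := by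
        refine mul_le_mul_of_nonneg_left (hprod b) ?_
        have := hv a; positivity
    _ = (κc * κs * B * Λ) * v a * Real.exp (-((1 - α) * δ * g.dist a b)) := by ring

/-! ## §2  (3.66)–(3.67): the algebra and `C(U′U) − C(U)`, `C⁻¹(U′U) − C⁻¹(U)` on 𝔅 in block-ℓ² -/

variable (blkX : X → g.Site) (blkY : Y → g.Site) (d : ℕ)

/-- ★ **`C′(A) = C(U′U) − C(U)` IN BLOCK-ℓ² ON 𝔅** («|C′(A)| ≦ O(1)α₁(Lʲη)⁴e^{−δd}», (3.66)): from the structured Hom-readings of `Q′`, `Q′*` at U′U and of the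
(3.57) variations `F′ = Q′(U′U) − Q′(U)`, `F′* = Q′*(U′U) − Q′*(U)` (diagonal, constants `θ_c`, `θ_s` — print: `c_Fα₁`), the weights' laws, the block-ℓ²
entries `G, G̃ ≺₂ B_G(Lʲη)²e^{−δd}` and the SMALL `G̃ − G ≺₂ θ_G(Lʲη)²e^{−δd}` (print: (3.65), `O(α₁)`), the transfer of `(Lʲη)²` and (2.61):
`C(U′U) − C(U) ≺₂ κ_cκ_sΛ_C·Λc₁·B_G·(θ_cB_G·κ_s/κ_s… ) …` — precisely `(Λ_C·Λ·c₁(β)·B_G·(θ_c·κ_s·B_G + κ_c·κ_s·2θ_G + κ_c·θ_s·B_G))·(Lʲη)⁴·e^{−(1−α_C)ρd}`,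
by `csq_sub_expand`, `hasL2Majorant_comp_decay` for the squares and three reverse sandwiches.
[cite: Balaban1985BackgroundPropagators, (3.66) p.403 + (3.57) p.402 + (3.65) p.403 + (3.21) p.393; Balaban1984PropagatorsII, Lemma 2.1 p.234 + (2.52)–(2.55) p.232 + Prop. 2.6 (2.140)–(2.141) p.247] -/
theorem hasL2Majorant_cDiff_sitesP (δ₀ δ α β ρ Λ αC ΛC κc κs θc θs BG θG : ℝ) (wc ws : g.Site → ℝ)
    (hκc : 0 ≤ κc) (hκs : 0 ≤ κs) (hθc : 0 ≤ θc) (hθs : 0 ≤ θs) (hBG : 0 ≤ BG) (hθG : 0 ≤ θG) (hΛ : 0 ≤ Λ) (hΛC : 0 ≤ ΛC)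
    (hρ : 0 ≤ ρ) (hα : 0 ≤ α) (hβ : 0 ≤ β) (hδ₀ : 0 ≤ δ₀) (hr : ρ + (α + β) * δ₀ ≤ δ)
    (hwc : ∀ a, 0 ≤ wc a) (hws : ∀ a, 0 ≤ ws a) (hprod : ∀ a, ws a * wc a ≤ 1)
    (hdnn : ∀ a b : g.Site, 0 ≤ g.dist a b) (hsym : ∀ a b : g.Site, g.dist a b = g.dist b a) (htri : Triangle254 (toB6 g R H))
    (h261 : Ineq261 d (toB6 g R H) δ₀ β) (hT2 : ScaleTransfer g δ₀ α Λ (fun a => g.len a ^ 2))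
    (hTC : ∀ a b : g.Site, Real.exp (-(αC * ρ * g.dist a b)) * wc b ≤ ΛC * wc a)
    {Qc Qc₁ : (X → ℝ) →ₗ[ℝ] (Y → ℝ)} {Qcs Qcs₁ : (Y → ℝ) →ₗ[ℝ] (X → ℝ)} {G Gt : Module.End ℝ (X → ℝ)}
    (hQc : HasL2MajorantHom (g := toB6 g R H) blkX blkY Qc (fun a b : g.Site => if a = b then κc * wc a else 0))
    (hQcs₁ : HasL2MajorantHom (g := toB6 g R H) blkY blkX Qcs₁ (fun a b : g.Site => if a = b then κs * ws a else 0))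
    (hFc : HasL2MajorantHom (g := toB6 g R H) blkX blkY (Qc₁ - Qc) (fun a b : g.Site => if a = b then θc * wc a else 0))
    (hFcs : HasL2MajorantHom (g := toB6 g R H) blkY blkX (Qcs₁ - Qcs) (fun a b : g.Site => if a = b then θs * ws a else 0))
    (hG : HasL2Majorant (g := toB6 g R H) blkX G (fun a b => BG * g.len a ^ 2 * Real.exp (-(δ * g.dist a b))))
    (hGt : HasL2Majorant (g := toB6 g R H) blkX Gt (fun a b => BG * g.len a ^ 2 * Real.exp (-(δ * g.dist a b))))
    (hdG : HasL2Majorant (g := toB6 g R H) blkX (Gt - G) (fun a b => θG * g.len a ^ 2 * Real.exp (-(δ * g.dist a b)))) :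
    HasL2Majorant (g := toB6 g R H) blkY (Qc₁ ∘ₗ (Gt * Gt) ∘ₗ Qcs₁ - Qc ∘ₗ (G * G) ∘ₗ Qcs)
      (fun a b => (ΛC * (Λ * B6.c1 d δ₀ β) * (θc * κs * (BG * BG) + κc * κs * (θG * BG + BG * θG) + κc * θs * (BG * BG))) *
        g.len a ^ 4 * Real.exp (-((1 - αC) * ρ * g.dist a b))) := by
  letI : DecidableEq (toB6 g R H).Site := ‹DecidableEq g.Site›
  have hw2 : ∀ a : g.Site, 0 ≤ g.len a ^ 2 := fun a => sq_nonneg _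
  have hw4 : ∀ a : g.Site, 0 ≤ g.len a ^ 4 := fun a => by positivity
  have hc : 0 ≤ B6.c1 d δ₀ β := B6RandomWalk.c1_nonneg _ _ _
  have hρδ : ρ ≤ δ := by nlinarith
  -- the squares on the fine carrier: weights (Lʲη)²·(Lʲη)² = (Lʲη)⁴ after one transfer
  have sq := fun (A₁ A₂ : ℝ) (hA₁ : 0 ≤ A₁) (hA₂ : 0 ≤ A₂) {T₁ T₂ : Module.End ℝ (X → ℝ)}
      (h₁ : HasL2Majorant (g := toB6 g R H) blkX T₁ (fun a b => A₁ * g.len a ^ 2 * Real.exp (-(δ * g.dist a b))))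
      (h₂ : HasL2Majorant (g := toB6 g R H) blkX T₂ (fun a b => A₂ * g.len a ^ 2 * Real.exp (-(δ * g.dist a b)))) =>
    hasL2Majorant_comp_decay (R := R) (H := H) blkX d δ₀ α β ρ δ Λ A₁ A₂ (fun a => g.len a ^ 2) (fun a => g.len a ^ 2) hw2 hw2 hΛ hA₁
      hA₂ hρ hr hdnn htri hT2 h261 h₁ (hasL2Majorant_rate_mono (R := R) (H := H) blkX A₂ (fun a => g.len a ^ 2) hA₂ hw2 hρδ hdnn h₂)
  have hGtGt := sq BG BG hBG hBG hGt hGt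
  have hGG := sq BG BG hBG hBG hG hG
  have hmid : HasL2Majorant (g := toB6 g R H) blkX ((Gt - G) * Gt + G * (Gt - G))
      (fun a b => (Λ * B6.c1 d δ₀ β * (θG * BG + BG * θG)) * g.len a ^ 4 * Real.exp (-(ρ * g.dist a b))) := by
    refine hasL2Majorant_mono (g := toB6 g R H) _ (hasL2Majorant_add (g := toB6 g R H) _ (sq θG BG hθG hBG hdG hGt) (sq BG θG hBG hθG hG hdG))
      fun a b => le_of_eq ?_
    ring
  have hGtGt' : HasL2Majorant (g := toB6 g R H) blkX (Gt * Gt)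
      (fun a b => (Λ * B6.c1 d δ₀ β * (BG * BG)) * g.len a ^ 4 * Real.exp (-(ρ * g.dist a b))) :=
    hasL2Majorant_mono (g := toB6 g R H) _ hGtGt fun a b => le_of_eq (by ring)
  have hGG' : HasL2Majorant (g := toB6 g R H) blkX (G * G)
      (fun a b => (Λ * B6.c1 d δ₀ β * (BG * BG)) * g.len a ^ 4 * Real.exp (-(ρ * g.dist a b))) :=
    hasL2Majorant_mono (g := toB6 g R H) _ hGG fun a b => le_of_eq (by ring)
  -- the three reverse sandwiches on 𝔅
  have s1 := hasL2Majorant_sandwich_revP (R := R) (H := H) blkX blkY ρ αC ΛC θc κs (Λ * B6.c1 d δ₀ β * (BG * BG)) wc ws (fun a => g.len a ^ 4)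
    hθc hκs (by positivity) hΛC hwc hws hw4 hprod hsym hTC hFc hGtGt' hQcs₁
  have s2 := hasL2Majorant_sandwich_revP (R := R) (H := H) blkX blkY ρ αC ΛC κc κs (Λ * B6.c1 d δ₀ β * (θG * BG + BG * θG)) wc ws
    (fun a => g.len a ^ 4) hκc hκs (by positivity) hΛC hwc hws hw4 hprod hsym hTC hQc hmid hQcs₁
  have s3 := hasL2Majorant_sandwich_revP (R := R) (H := H) blkX blkY ρ αC ΛC κc θs (Λ * B6.c1 d δ₀ β * (BG * BG)) wc ws (fun a => g.len a ^ 4)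
    hκc hθs (by positivity) hΛC hwc hws hw4 hprod hsym hTC hQc hGG' hFcs
  rw [csq_sub_expand]
  refine hasL2Majorant_mono (g := toB6 g R H) _
    (hasL2Majorant_add (g := toB6 g R H) _ (hasL2Majorant_add (g := toB6 g R H) _ s1 s2) s3) fun a b => le_of_eq ?_
  ring

omit [DecidableEq g.Site] in
/-- ★ **(3.67) IN BLOCK-ℓ² ON 𝔅: `C⁻¹(U′U) − C⁻¹(U) ≺₂ (Λc₁)²·B₁′·θ_C·B₁·(Lʲη)⁻⁴·e^{−ρ′d}`** from the ENTRY bounds of `C⁻¹(U)` (Theorem 3.2 (3.48) at U,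
`B₁`) and of `C⁻¹(U′U)` (the kernel step's output at U′U, `B₁′`) on 𝔅, the block-ℓ² bound `C(U′U) − C(U) ≺₂ θ_C(Lʲη)⁴e^{−δd}` (e.g. `hasL2Majorant_cDiff_sitesP`),
the inverse laws `C(U)C⁻¹(U) = 1`, `C⁻¹(U′U)C(U′U) = 1` (`cinv_sub_eq`), the transfer of `(Lʲη)⁻⁴` and (2.61) (two compositions; the second transfer is free).
[cite: Balaban1985BackgroundPropagators, (3.66)–(3.67) p.403 + Thm 3.2 (3.48) p.398; Balaban1984PropagatorsII, Lemma 2.1 p.234 + (2.52)–(2.55) p.232 + Prop. 2.6 (2.140)–(2.141) p.247] -/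
theorem hasL2Majorant_copDiff_sitesP (δ₀ δ α β ρ ρ' Λ B₁ B₁' θC : ℝ)
    (hB₁ : 0 ≤ B₁) (hB₁' : 0 ≤ B₁') (hθC : 0 ≤ θC) (hΛ : 0 ≤ Λ) (hρ : 0 ≤ ρ) (hρ' : 0 ≤ ρ') (hα : 0 ≤ α) (hβ : 0 ≤ β) (hδ₀ : 0 ≤ δ₀)
    (hr : ρ + (α + β) * δ₀ ≤ δ) (hr' : ρ' + (α + β) * δ₀ ≤ ρ)
    (hdnn : ∀ a b : g.Site, 0 ≤ g.dist a b) (htri : Triangle254 (toB6 g R H)) (hlen : ∀ y : g.Site, 0 < g.len y)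
    (h261 : Ineq261 d (toB6 g R H) δ₀ β) (hT4 : ScaleTransfer g δ₀ α Λ (fun a => (g.len a ^ 4)⁻¹))
    {C C₁ Cop Cop₁ : Module.End ℝ (Y → ℝ)} (hinv : C * Cop = 1) (hinv₁ : Cop₁ * C₁ = 1)
    (hL : HasL2Majorant (g := toB6 g R H) blkY Cop (fun a b => B₁ * (g.len a ^ 4)⁻¹ * Real.exp (-(δ * g.dist a b))))
    (hL₁ : HasL2Majorant (g := toB6 g R H) blkY Cop₁ (fun a b => B₁' * (g.len a ^ 4)⁻¹ * Real.exp (-(δ * g.dist a b))))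
    (hC : HasL2Majorant (g := toB6 g R H) blkY (C₁ - C) (fun a b => θC * g.len a ^ 4 * Real.exp (-(δ * g.dist a b)))) :
    HasL2Majorant (g := toB6 g R H) blkY (Cop₁ - Cop)
      (fun a b => (1 * B6.c1 d δ₀ β * B₁' * (Λ * B6.c1 d δ₀ β * θC * B₁)) * (g.len a ^ 4)⁻¹ * Real.exp (-(ρ' * g.dist a b))) := by
  have hw4 : ∀ a : g.Site, 0 ≤ g.len a ^ 4 := fun a => by positivity
  have hw4i : ∀ a : g.Site, 0 ≤ (g.len a ^ 4)⁻¹ := fun a => inv_nonneg.mpr (hw4 a)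
  have hw0 : ∀ _a : g.Site, 0 ≤ (1 : ℝ) := fun _ => zero_le_one
  have hc : 0 ≤ B6.c1 d δ₀ β := B6RandomWalk.c1_nonneg _ _ _
  have hρδ : ρ ≤ δ := by nlinarith
  -- (C₁ − C)·Cop: weights (Lʲη)⁴·(Lʲη)⁻⁴ = 1 after the transfer of (Lʲη)⁻⁴
  have w1 := hasL2Majorant_comp_decay (R := R) (H := H) blkY d δ₀ α β ρ δ Λ θC B₁ (fun a => g.len a ^ 4)
    (fun a => (g.len a ^ 4)⁻¹) hw4 hw4i hΛ hθC hB₁ hρ hr hdnn htri hT4 h261 hC (hasL2Majorant_rate_mono (R := R) (H := H) _ B₁ _ hB₁ hw4i hρδ hdnn hL)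
  have w1' : HasL2Majorant (g := toB6 g R H) blkY ((C₁ - C) * Cop)
      (fun a b => (Λ * B6.c1 d δ₀ β * θC * B₁) * (1 : ℝ) * Real.exp (-(ρ * g.dist a b))) := by
    refine hasL2Majorant_mono (g := toB6 g R H) _ w1 fun a b => le_of_eq ?_
    have ha : g.len a ^ 4 ≠ 0 := pow_ne_zero 4 (hlen a).ne'
    rw [mul_inv_cancel₀ ha]; ring
  have hρ'ρ : ρ' ≤ ρ := by nlinarith
  have w1'' := hasL2Majorant_rate_mono (R := R) (H := H) blkY (Λ * B6.c1 d δ₀ β * θC * B₁) (fun _ => (1 : ℝ))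
    (by positivity) hw0 hρ'ρ hdnn w1'
  -- Cop₁·((C₁ − C)·Cop): the transfer of the constant weight is free
  have hT1 : ScaleTransfer g δ₀ α 1 (fun _ => (1 : ℝ)) := scaleTransfer_one (mul_nonneg hα hδ₀) hdnn
  have w2 := hasL2Majorant_comp_decay (R := R) (H := H) blkY d δ₀ α β ρ' ρ 1 B₁' (Λ * B6.c1 d δ₀ β * θC * B₁)
    (fun a => (g.len a ^ 4)⁻¹) (fun _ => (1 : ℝ)) hw4i hw0 zero_le_one hB₁' (by positivity) hρ' hr' hdnn htri hT1 h261
    (hasL2Majorant_rate_mono (R := R) (H := H) _ B₁' _ hB₁' hw4i hρδ hdnn hL₁) w1''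
  rw [cinv_sub_eq hinv hinv₁]
  refine hasL2Majorant_mono (g := toB6 g R H) _ (hasL2Majorant_neg (R := R) (H := H) _ ?_) fun a b => le_rfl
  have e : Cop₁ * (C₁ - C) * Cop = Cop₁ * ((C₁ - C) * Cop) := mul_assoc _ _ _
  rw [e]
  exact hasL2Majorant_mono (g := toB6 g R H) _ w2 fun a b => le_of_eq (by ring)

/-! ## §3  The sandwiched letters `M`, `M′` and their small difference on the fine carrier -/

/-- ★★ **`M′ − M = Q′*(U′U)C⁻¹(U′U)Q′(U′U) − Q′*(U)C⁻¹(U)Q′(U)` IN BLOCK-ℓ² ON THE FINE CARRIER, FROM READINGS** — the SMALL sandwiched letter of (3.68):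
from the structured Hom-readings of `Q′, Q′*` at U and U′U, of `F′ = Q′(U′U) − Q′(U)`, `F′* ` (constants `θ_c`, `θ_s`, print `c_Fα₁`), the weights' laws and
the transfer of `w_c` at `(ρ′, α_C)`, the ENTRY bound of `C⁻¹(U)` on 𝔅 and a block-ℓ² bound `C⁻¹(U′U) − C⁻¹(U) ≺₂ θ_I(Lʲη)⁻⁴e^{−ρ′d}` on 𝔅 (e.g.
`hasL2Majorant_copDiff_sitesP`): `M′ − M ≺₂ Λ_C·(κ_s²… )` — precisely `(Λ_C·(κ_sκ_cθ_I + θ_sκ_cB₁ + κ_sθ_cB₁))·(Lʲη)⁻⁴·e^{−(1−α_C)ρ′d}`, by `m_sub_expand`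
and three sandwiches `B6RandomWalkL2Hom.hasL2Majorant_sandwich`.
[cite: Balaban1985BackgroundPropagators, (3.57) p.402 + (3.66)–(3.68) p.403 + (3.25) p.394; Balaban1984PropagatorsII, (2.52)–(2.55) p.232 + Prop. 2.6 (2.140)–(2.141) p.247] -/
theorem hasL2Majorant_mDiff_of_readingsP (ρ' δ αC ΛC κc κs θc θs B₁ θI : ℝ) (wc ws : g.Site → ℝ)
    (hκc : 0 ≤ κc) (hκs : 0 ≤ κs) (hθc : 0 ≤ θc) (hθs : 0 ≤ θs) (hB₁ : 0 ≤ B₁) (hθI : 0 ≤ θI) (hΛC : 0 ≤ ΛC) (hρ'δ : ρ' ≤ δ)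
    (hws : ∀ a, 0 ≤ ws a) (hprod : ∀ a, ws a * wc a ≤ 1) (hdnn : ∀ a b : g.Site, 0 ≤ g.dist a b)
    (hTC : ∀ a b : g.Site, Real.exp (-(αC * ρ' * g.dist a b)) * wc b ≤ ΛC * wc a)
    {Qc Qc₁ : (X → ℝ) →ₗ[ℝ] (Y → ℝ)} {Qcs Qcs₁ : (Y → ℝ) →ₗ[ℝ] (X → ℝ)} {Cop Cop₁ : Module.End ℝ (Y → ℝ)}
    (hQc₁ : HasL2MajorantHom (g := toB6 g R H) blkX blkY Qc₁ (fun a b : g.Site => if a = b then κc * wc a else 0))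
    (hQcs : HasL2MajorantHom (g := toB6 g R H) blkY blkX Qcs (fun a b : g.Site => if a = b then κs * ws a else 0))
    (hQcs₁ : HasL2MajorantHom (g := toB6 g R H) blkY blkX Qcs₁ (fun a b : g.Site => if a = b then κs * ws a else 0))
    (hFc : HasL2MajorantHom (g := toB6 g R H) blkX blkY (Qc₁ - Qc) (fun a b : g.Site => if a = b then θc * wc a else 0))
    (hFcs : HasL2MajorantHom (g := toB6 g R H) blkY blkX (Qcs₁ - Qcs) (fun a b : g.Site => if a = b then θs * ws a else 0))
    (h348 : HasL2Majorant (g := toB6 g R H) blkY Cop (fun a b => B₁ * (g.len a ^ 4)⁻¹ * Real.exp (-(δ * g.dist a b))))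
    (hI : HasL2Majorant (g := toB6 g R H) blkY (Cop₁ - Cop)
      (fun a b => θI * (g.len a ^ 4)⁻¹ * Real.exp (-(ρ' * g.dist a b)))) :
    HasL2Majorant (g := toB6 g R H) blkX (Qcs₁ ∘ₗ Cop₁ ∘ₗ Qc₁ - Qcs ∘ₗ Cop ∘ₗ Qc)
      (fun a b => (ΛC * (κs * κc * θI + θs * κc * B₁ + κs * θc * B₁)) * (g.len a ^ 4)⁻¹ *
        Real.exp (-((1 - αC) * ρ' * g.dist a b))) := by
  letI : DecidableEq (toB6 g R H).Site := ‹DecidableEq g.Site›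
  have hw4i : ∀ a : g.Site, 0 ≤ (g.len a ^ 4)⁻¹ := fun a => inv_nonneg.mpr (by positivity)
  have hL : HasL2Majorant (g := toB6 g R H) blkY Cop (fun a b => B₁ * (g.len a ^ 4)⁻¹ * Real.exp (-(ρ' * g.dist a b))) :=
    hasL2Majorant_rate_mono (R := R) (H := H) _ B₁ (fun a => (g.len a ^ 4)⁻¹) hB₁ hw4i hρ'δ hdnn h348
  have s1 := hasL2Majorant_sandwichP (G₆ := toB6 g R H) blkX blkY ρ' αC ΛC κc κs θI wc ws (fun a => (g.len a ^ 4)⁻¹) hκc hκs hθI hΛC hws hw4i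
    hprod hTC hQc₁ hI hQcs₁
  have s2 := hasL2Majorant_sandwichP (G₆ := toB6 g R H) blkX blkY ρ' αC ΛC κc θs B₁ wc ws (fun a => (g.len a ^ 4)⁻¹) hκc hθs hB₁ hΛC hws hw4i
    hprod hTC hQc₁ hL hFcs
  have s3 := hasL2Majorant_sandwichP (G₆ := toB6 g R H) blkX blkY ρ' αC ΛC θc κs B₁ wc ws (fun a => (g.len a ^ 4)⁻¹) hθc hκs hB₁ hΛC hws hw4i
    hprod hTC hFc hL hQcs
  have s1' : HasL2Majorant (g := toB6 g R H) blkX (Qcs₁ ∘ₗ (Cop₁ - Cop) ∘ₗ Qc₁)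
      (fun a b => κs * κc * θI * ΛC * (g.len a ^ 4)⁻¹ * Real.exp (-((1 - αC) * ρ' * g.dist a b))) := s1
  have s2' : HasL2Majorant (g := toB6 g R H) blkX ((Qcs₁ - Qcs) ∘ₗ Cop ∘ₗ Qc₁)
      (fun a b => θs * κc * B₁ * ΛC * (g.len a ^ 4)⁻¹ * Real.exp (-((1 - αC) * ρ' * g.dist a b))) := s2
  have s3' : HasL2Majorant (g := toB6 g R H) blkX (Qcs ∘ₗ Cop ∘ₗ (Qc₁ - Qc))
      (fun a b => κs * θc * B₁ * ΛC * (g.len a ^ 4)⁻¹ * Real.exp (-((1 - αC) * ρ' * g.dist a b))) := s3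
  rw [m_sub_expand]
  refine hasL2Majorant_mono (g := toB6 g R H) _
    (hasL2Majorant_add (g := toB6 g R H) _ (hasL2Majorant_add (g := toB6 g R H) _ s1' s2') s3') fun a b => le_of_eq ?_
  ring

end Literature.MathematicalPhysics.QuantumFieldTheory.Balaban1983to89.B9Ineq368L2MLettersP

end
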